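import Literature.IUT.HodgeArakelov.GoodPrimeKummerBridgeArch
import Literature.IUT.HodgeArakelov.GoodPrimeKummerBridgeTheta
import Literature.IUT.HodgeArakelov.HodgeTheaterKitBridge
import HarnessLib

/-!
# [IUTchII] Prop 4.4 at archimedean primes — the unit groups WITH THEIR TOPOLOGIES, the `{±1}`-orbit of
# `φ^×`, and (iii)/(iv) instantiated (complement to `GoodPrimeKummerBridgeArch.lean`)

S. Mochizuki, *Inter-universal Teichmüller theory II*, §4, kurims manuscript (Dec. 2020), Proposition 4.4
(i)–(iv) pp. 129–131 (`v ∈ V^arc`), read on the page (lit key `paper:url-5036b4059555`, pp. 127–131)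
[cite: Mochizuki2012, Prop 4.4 p.129]. Claim key DISPUTED (D-0012). Printed proof (p. 131): "The various
assertions of Proposition 4.4 follow immediately from the definitions and the references quoted in the
statements of these assertions."

WHY THIS FILE. `GoodPrimeKummerBridgeArch.lean` (p416766) proves Prop 4.4 (i) (`kummerIsoArch`: the unique
isomorphism of monoids `Ψ_{†F_v} = 𝒪^▷(†C_v) ⥲ 𝒪^▷_{𝒜_{D_v}} = Ψ_cns(†U_v)` through which `†κ_v` factors, with
`kummerIsoArch_continuous` / `_symm_continuous`) and the unit part of (ii) AT THE LEVEL OF THE UNIT SPHERES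
`S¹(K_v) ⥲ S¹(𝒜_{D_v})` (`Prop44iiUnit_holds`), the identification `Ψ^×_{†F^⊢_v} = 𝒪^×(C^⊢_v) ≅ S¹(K_v)` being the
bare group isomorphism `unitsDashEquivSphere` (auditor abc-iut-w4-d022, INFO A1 on p416766). THIS FILE makes
the three printed phrases literal on the printed objects, with their own topologies, and links (ii) to (i):
* "isomorphism `Ψ_{†F_v} ⥲ Ψ_cns(†U_v)` of topological monoids" (p. 129): `kummerTopIsoArch : X.OC ≃ₜ* 𝒪^▷_{𝒜_{D_v}}`,
  unique among isomorphisms of TOPOLOGICAL monoids compatible with `†κ_v` (`existsUnique_topIso_kappa`);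
* "`(𝒪^▷)^×` … necessarily isomorphic to `S¹`" ([IUTchI] Ex 3.4 (ii) p. 81) as an isomorphism of
  TOPOLOGICAL groups for the unit-group topology (`unitsTopEquivSphere`);
* "a unique `{±1}`-orbit of isomorphisms of topological groups `Ψ^×_{†F^⊢_v} ⥲ Ψ_cns(†D^⊢_v)^×`" (pp. 129–130)
  ON `Ψ^×_{†F^⊢_v} = 𝒪^▷(†C^⊢_v)^× = X.OCˣ` and `Ψ_cns(†D^⊢_v)^× = (𝒪^▷_{𝒜_{D_v}})^×` (the unit group of abc-iut's
  `ConstantMonoidDatum.ofArch X`), with orbit representative `φ^×` = the units of the isomorphism of (i):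
  EVERY isomorphism of topological groups `Ψ^×_{†F^⊢_v} ⥲ Ψ_cns(†D^⊢_v)^×` is `φ^×` or `φ^×` followed by inversion
  (`unitKummerTopIso_orbit`, `existsUnique_orbit_unitGroups`) — which is the form Prop 4.4 (iv) p. 131
  consumes: the theta/Gaussian isomorphisms "restrict to the identity or to the [restriction to
  “`(−)^×`” of the] isomorphism of (i) [or its inverse] on the various copies of `Ψ^×_{†F_v}`, “`Ψ_cns(†U_v)^×`”";
* (iii), (iv) pp. 130–131 at the archimedean data: the place-independent constructions of
  `GoodPrimeKummerBridgeTheta.lean` (p415883) INSTANTIATED at `ConstantMonoidDatum.ofArch X` with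
  `φ^× := Units.mapEquiv kummerIsoArch` (`archLabeledIso`, `arch_diagonalIso_labeled_comm`,
  `archThetaKummerIso`, `archGaussianKummerIso`, `archThetaKummerIso_unit`, `arch_evalIso_chain`).

Theorems and plumbing definitions only — no new `Prop`-valued definition, no named hypothesis; the one
external input is abc-iut-L4's PROVED `Rmk_2_7_3.CircleAutOrderTwo_holds` via p416766's
`orbit_of_equiv_circle`. HONEST FRAMING: elementary topology/algebra over the cell's interfaces; nothing
here bears on [IUTchIII] Cor. 3.12 or takes a side; typed ≠ discharged elsewhere.
-/

noncomputable section

open scoped _root_.Topology _root_.NNReal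

namespace Literature.IUT.HodgeArakelov

open Literature.IUT.HodgeTheaters

universe u w

namespace GoodPrimeKummer

/-! ### 1. Unit groups with their topologies -/

section UnitsTopology

variable {K : Type*} [NormedField K]

/-- `(𝒪^▷_K)^× ⥲ S¹(K)` as an isomorphism of TOPOLOGICAL groups (unit-group topology on the left, subspace
topology on Mathlib's `Metric.sphere 0 1` on the right): underlying elements unchanged, inverse
`z ↦ (z, z⁻¹)` — [IUTchI] Ex 3.4 (ii) p. 81 "`C^×`, which is necessarily isomorphic to `S¹`, denotes the
topological submonoid of invertible elements". [cite: Mochizuki2012, IUTchI Ex 3.4 (ii) p.81] -/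
def unitsTopEquivSphere : (unitDiscMonoid K)ˣ ≃ₜ* Metric.sphere (0 : K) 1 where
  toFun u := ⟨((u : unitDiscMonoid K) : K), mem_sphere_zero_iff_norm.2 (norm_eq_one_of_isUnit u.isUnit)⟩
  invFun z :=
    { val := ⟨(z : K), ne_zero_of_mem_unit_sphere z, (mem_sphere_zero_iff_norm.1 z.2).le⟩
      inv := ⟨(z : K)⁻¹, inv_ne_zero (ne_zero_of_mem_unit_sphere z),
        by rw [norm_inv, mem_sphere_zero_iff_norm.1 z.2, inv_one]⟩
      val_inv := Subtype.ext (mul_inv_cancel₀ (ne_zero_of_mem_unit_sphere z))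
      inv_val := Subtype.ext (inv_mul_cancel₀ (ne_zero_of_mem_unit_sphere z)) }
  left_inv u := Units.ext (Subtype.ext rfl)
  right_inv z := Subtype.ext rfl
  map_mul' _ _ := Subtype.ext rfl
  continuous_toFun := (continuous_subtype_val.comp Units.continuous_val).subtype_mk _
  continuous_invFun := by
    refine Units.continuous_iff.2 ⟨?_, ?_⟩
    · exact continuous_subtype_val.subtype_mk _
    · exact (continuous_subtype_val.inv₀ fun z => ne_zero_of_mem_unit_sphere z).subtype_mk _

/-- `unitsTopEquivSphere` is the identity on underlying elements. [cite: Mochizuki2012, IUTchI Ex 3.4 (ii) p.81] -/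
@[simp] theorem coe_unitsTopEquivSphere_apply (u : (unitDiscMonoid K)ˣ) :
    ((unitsTopEquivSphere u : Metric.sphere (0 : K) 1) : K) = ((u : unitDiscMonoid K) : K) := rfl

/-- Its underlying group isomorphism is p416766's `unitsUnitDiscEquivSphere`. [cite: Mochizuki2012, IUTchI Ex 3.4 (ii) p.81] -/
theorem unitsTopEquivSphere_apply_eq (u : (unitDiscMonoid K)ˣ) :
    unitsTopEquivSphere u = unitsUnitDiscEquivSphere u := Subtype.ext rfl

variable {M N : Type*} [Monoid M] [TopologicalSpace M] [Monoid N] [TopologicalSpace N]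

/-- The isomorphism of TOPOLOGICAL unit groups `M^× ⥲ N^×` induced by a bicontinuous isomorphism of
topological monoids `M ⥲ N` ("restriction to “`(−)^×`”", [IUTchII] Prop 4.4 (iv) p. 131).
[cite: Mochizuki2012, Prop 4.4 (iv) p.131] -/
def unitsMapTopEquiv (e : M ≃* N) (he : Continuous e) (he' : Continuous e.symm) : Mˣ ≃ₜ* Nˣ :=
  { Units.mapEquiv e with
    continuous_toFun := Units.continuous_map (f := e.toMonoidHom) he
    continuous_invFun := Units.continuous_map (f := e.symm.toMonoidHom) he' }

/-- `unitsMapTopEquiv e` is `e` on underlying elements. [cite: Mochizuki2012, Prop 4.4 (iv) p.131] -/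
@[simp] theorem coe_unitsMapTopEquiv_apply (e : M ≃* N) (he : Continuous e) (he' : Continuous e.symm)
    (u : Mˣ) : ((unitsMapTopEquiv e he he' u : Nˣ) : N) = e (u : M) := rfl

end UnitsTopology

/-! ### 2. Prop 4.4 (i) "of topological monoids" and its unit part `φ^×` -/

section ConstantMonoids

variable {Kv : Type u} [NormedField Kv] [NormedAlgebra ℝ Kv] (X : ArchLocalFrobenioid.{u} Kv)

/-- **The isomorphism of TOPOLOGICAL monoids `Ψ_{†F_v} ⥲ Ψ_cns(†U_v)` of [IUTchII] Prop 4.4 (i)** (p. 129):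
p416766's `kummerIsoArch` bundled with its bicontinuity. [cite: Mochizuki2012, Prop 4.4 (i) p.129] -/
def kummerTopIsoArch : X.OC ≃ₜ* unitDiscMonoid X.Afield :=
  { kummerIsoArch X with
    continuous_toFun := kummerIsoArch_continuous X
    continuous_invFun := kummerIsoArch_symm_continuous X }

/-- `†κ_v` factors through `kummerTopIsoArch`. [cite: Mochizuki2012, Prop 4.4 (i) p.129] -/
@[simp] theorem coe_kummerTopIsoArch (m : X.OC) : (kummerTopIsoArch X m : X.Afield) = X.kappa m := rfl

/-- **Prop 4.4 (i) literally** (p. 129 "determine a unique isomorphism `Ψ_{†F_v} ⥲ Ψ_cns(†U_v)` of topological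
monoids"): among isomorphisms of TOPOLOGICAL monoids `𝒪^▷(†C_v) ⥲ 𝒪^▷_{𝒜_{D_v}}` there is exactly one through
which `†κ_v` factors — PROVED. [cite: Mochizuki2012, Prop 4.4 (i) p.129] -/
theorem existsUnique_topIso_kappa :
    ∃! φ : X.OC ≃ₜ* unitDiscMonoid X.Afield, ∀ m : X.OC, (φ m : X.Afield) = X.kappa m := by
  refine ⟨kummerTopIsoArch X, coe_kummerTopIsoArch X, fun φ hφ => ?_⟩
  apply ContinuousMulEquiv.ext
  intro m
  exact Subtype.ext ((hφ m).trans (coe_kummerTopIsoArch X m).symm)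

/-- **`φ^×`**: the unit part of the isomorphism of (i), an isomorphism of TOPOLOGICAL groups
`Ψ^×_{†F^⊢_v} = 𝒪^▷(†C^⊢_v)^× ⥲ (𝒪^▷_{𝒜_{D_v}})^× = Ψ_cns(†D^⊢_v)^×` (`†C^⊢_v := †C_v`, [IUTchI] Ex 3.4 (ii); abc-iut-L5-t2's
`unitsDash X = X.OCˣ` with the unit-group topology of `𝒪^▷(†C_v)`; the unit group of
`ConstantMonoidDatum.ofArch X`). [cite: Mochizuki2012, Prop 4.4 (ii) p.129] -/
def unitKummerTopIso : X.OCˣ ≃ₜ* (unitDiscMonoid X.Afield)ˣ :=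
  unitsMapTopEquiv (kummerIsoArch X) (kummerIsoArch_continuous X) (kummerIsoArch_symm_continuous X)

/-- `φ^×` is `†κ_v` on underlying elements. [cite: Mochizuki2012, Prop 4.4 (ii) p.129] -/
@[simp] theorem coe_unitKummerTopIso (u : X.OCˣ) :
    (((unitKummerTopIso X u : (unitDiscMonoid X.Afield)ˣ) : unitDiscMonoid X.Afield) : X.Afield) =
      X.kappa (u : X.OC) := rfl

/-- The underlying group isomorphism of `φ^×` is `Units.mapEquiv kummerIsoArch`. [cite: Mochizuki2012, Prop 4.4 (ii) p.129] -/
theorem unitKummerTopIso_apply (u : X.OCˣ) :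
    unitKummerTopIso X u = Units.mapEquiv (kummerIsoArch X) u := rfl

/-! ### 3. Prop 4.4 (ii), unit part, on `Ψ^×_{†F^⊢_v} ⥲ Ψ_cns(†D^⊢_v)^×` itself: the orbit `{φ^×, (φ^×)⁻¹}` -/

/-- Post-composing twice with inversion is the identity (the `{±1}`-action is an involution).
[cite: Mochizuki2012, Prop 4.4 (ii) p.129] -/
theorem trans_invEquiv_trans_invEquiv {G H : Type*} [Mul G] [TopologicalSpace G] [CommGroup H]
    [TopologicalSpace H] [IsTopologicalGroup H] (χ : G ≃ₜ* H) :
    (χ.trans (invEquiv H)).trans (invEquiv H) = χ :=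
  ContinuousMulEquiv.ext fun g => by
    simp only [ContinuousMulEquiv.trans_apply, invEquiv_apply, inv_inv]

/-- **[IUTchII] Prop 4.4 (ii), unit part, on the printed groups with the representative of (i)**: EVERY
isomorphism of topological groups `Ψ^×_{†F^⊢_v} ⥲ Ψ_cns(†D^⊢_v)^×` is `φ^×` or `φ^×` followed by inversion
(`(φ^×)⁻¹` pointwise) — the `{±1}`-orbit of `φ^×` exhausts them. From p416766's `orbit_of_equiv_circle`
([AbsTopIII] Rmk 2.7.3 via abc-iut-L4's `CircleAutOrderTwo_holds`) applied to `Ψ^×_{†F^⊢_v} ≅ S¹(K_v) ≅ S¹` and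
`Ψ_cns(†D^⊢_v)^× ≅ S¹(𝒜_{D_v}) ≅ S¹` as TOPOLOGICAL groups. [cite: Mochizuki2012, Prop 4.4 (ii) p.129] -/
theorem unitKummerTopIso_orbit (ψ : X.OCˣ ≃ₜ* (unitDiscMonoid X.Afield)ˣ) :
    ψ = unitKummerTopIso X ∨ ψ = (unitKummerTopIso X).trans (invEquiv _) := by
  obtain ⟨e, he, he'⟩ := X.caf
  obtain ⟨e₀, he₀, he₀'⟩ := base_isCAF X
  obtain ⟨ψ₁, hψ₁⟩ := orbit_of_equiv_circle
    ((unitsMapTopEquiv X.isoOK X.isoOK_continuous X.isoOK_continuous_symm).trans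
      ((unitsTopEquivSphere (K := Kv)).trans (sphereEquiv e₀ he₀ he₀')))
    ((unitsTopEquivSphere (K := X.Afield)).trans (sphereEquiv e he he'))
  rcases hψ₁ (unitKummerTopIso X) with h0 | h0 <;> rcases hψ₁ ψ with h1 | h1
  · left
    rw [h1, h0]
  · right
    rw [h1, h0]
  · right
    rw [h1, h0, trans_invEquiv_trans_invEquiv]
  · left
    rw [h1, h0]

/-- Hence the printed "unique `{±1}`-orbit of isomorphisms of topological groups
`Ψ^×_{†F^⊢_v} ⥲ Ψ_cns(†D^⊢_v)^×`" ON THESE GROUPS: some isomorphism of topological groups exists and every one lies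
in its `{±1}`-orbit — PROVED, with the orbit of `φ^×` as witness. [cite: Mochizuki2012, Prop 4.4 (ii) p.129] -/
theorem existsUnique_orbit_unitGroups :
    ∃ ψ₀ : X.OCˣ ≃ₜ* (unitDiscMonoid X.Afield)ˣ,
      ∀ ψ : X.OCˣ ≃ₜ* (unitDiscMonoid X.Afield)ˣ, ψ = ψ₀ ∨ ψ = ψ₀.trans (invEquiv _) :=
  ⟨unitKummerTopIso X, unitKummerTopIso_orbit X⟩

/-- The orbit has exactly two members: `φ^× ≠ (φ^×)⁻¹` (the unit group of a complex archimedean field has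
an element that is not its own inverse, e.g. the image of `i ∈ S¹`). [cite: Mochizuki2012, Prop 4.4 (ii) p.129] -/
theorem unitKummerTopIso_ne_trans_invEquiv :
    unitKummerTopIso X ≠ (unitKummerTopIso X).trans (invEquiv _) := by
  obtain ⟨e, he, he'⟩ := X.caf
  intro h
  -- the unit `i` of `𝒪^▷_{𝒜_{D_v}}` (norm one) is not its own inverse
  let T := (unitsTopEquivSphere (K := X.Afield)).trans (sphereEquiv e he he')
  let iA : (unitDiscMonoid X.Afield)ˣ := T.symm ⟨Complex.I, by simp⟩
  have hu := DFunLike.congr_fun h ((unitKummerTopIso X).symm iA)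
  rw [ContinuousMulEquiv.trans_apply, ContinuousMulEquiv.apply_symm_apply, invEquiv_apply] at hu
  have hT : T iA = (T iA)⁻¹ := by
    conv_lhs => rw [hu]
    rw [map_inv]
  have hI : (T iA : ℂ) = Complex.I := by
    change ((T (T.symm _) : Metric.sphere (0 : ℂ) 1) : ℂ) = Complex.I
    rw [ContinuousMulEquiv.apply_symm_apply]
  have h2 := congrArg (fun z : Metric.sphere (0 : ℂ) 1 => (z : ℂ)) hT
  simp only [Metric.unitSphere.coe_inv, hI, Complex.inv_I] at h2
  exact (neg_ne_self.mpr Complex.I_ne_zero).symm h2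

end ConstantMonoids

/-! ### 4. Prop 4.4 (iii), (iv) at the archimedean data: the generic constructions instantiated -/

section ThetaGaussianArch

variable {Kv : Type u} [NormedField Kv] [NormedAlgebra ℝ Kv] (X : ArchLocalFrobenioid.{u} Kv)

/-- **[IUTchII] Prop 4.4 (iii)** (p. 130: "The isomorphism of (i) determines, for each `t ∈ LabCusp^±(†U_v)`, a
collection of compatible isomorphisms `(Ψ_{†F_v})_t ⥲ Ψ_cns(†U_v)_t`") at the archimedean data: the labeled
copies of the isomorphism of (i) (p415883's `labeledIso`, labels `T`). [cite: Mochizuki2012, Prop 4.4 (iii) p.130] -/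
def archLabeledIso (T : Type w) : (T → X.OC) ≃* (T → unitDiscMonoid X.Afield) :=
  labeledIso T (kummerIsoArch X)

/-- Prop 4.4 (iii), last display ("an isomorphism of topological monoids `(Ψ_{†F_v})_0 ⥲ (Ψ_{†F_v})_{⟨F_l^⋇⟩}`") at
the archimedean data: the isomorphisms `Ψ_0 ⥲ Ψ_{⟨T⟩}` of the two sides are intertwined by the isomorphism
of (i) and its labeled diagonal version. [cite: Mochizuki2012, Prop 4.4 (iii) p.130] -/
theorem arch_diagonalIso_labeled_comm (T : Type w) [Nonempty T] (m : X.OC) :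
    diagonalLabeledIso T (kummerIsoArch X) (diagonalIso T X.OC m) =
      diagonalIso T (unitDiscMonoid X.Afield) (kummerIsoArch X m) :=
  diagonalIso_labeled_comm (kummerIsoArch X) m

/-- The Frobenioid-side constant-monoid datum at an archimedean place ([IUTchII] Prop 4.4 (iv) p. 130:
`Ψ_{†F^Θ_v}`, `Ψ_{F_gau}(†F_v)` "determined … via the isomorphisms of (i), (ii), and (iii) — by the monoids
`Ψ_env(†U_v)`, `Ψ_gau(†U_v)` and splittings of Proposition 4.3, (iv)"): units `Ψ^×_{†F_v} = 𝒪^▷(†C_v)^×`, the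
archimedean `R_{≥0} ∋ log(p_v) = 1` (p415883's `frobeniusSide` over `ConstantMonoidDatum.ofArch`).
[cite: Mochizuki2012, Prop 4.4 (iv) p.130] -/
abbrev archFrobeniusSide : ConstantMonoidDatum.{u} :=
  frobeniusSide (ConstantMonoidDatum.ofArch X) (CommGrpCat.of X.OCˣ)

/-- `φ^×` as the parameter `Ψ^×_{†F_v} ⥲ Ψ_cns(†U_v)^×` of the generic theta / Gaussian constructions.
[cite: Mochizuki2012, Prop 4.4 (iv) p.130] -/
def archUnitKummerMulEquiv :
    (CommGrpCat.of X.OCˣ : CommGrpCat.{u}) ≃* (ConstantMonoidDatum.ofArch X).Units :=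
  Units.mapEquiv (kummerIsoArch X)

/-- **[IUTchII] Prop 4.4 (iv)**, first isomorphism `Ψ_{†F^Θ_v} ⥲ Ψ_env(†U_v)` (p. 130) at the archimedean data:
`φ^×` on units, identity on the ray `R_{≥0}·log(p_v)·log(Θ)`. [cite: Mochizuki2012, Prop 4.4 (iv) p.130] -/
def archThetaKummerIso :
    (archFrobeniusSide X).ThetaMonoid ≃* (ConstantMonoidDatum.ofArch X).ThetaMonoid :=
  thetaKummerIso (ConstantMonoidDatum.ofArch X) (CommGrpCat.of X.OCˣ) (archUnitKummerMulEquiv X)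

/-- **[IUTchII] Prop 4.4 (iv)**, third isomorphism `Ψ_gau(†U_v) ⥲ Ψ_{F_gau}(†F_v)` (p. 130) at the archimedean
data. [cite: Mochizuki2012, Prop 4.4 (iv) p.130] -/
def archGaussianKummerIso (lstar : ℕ) :
    (ConstantMonoidDatum.ofArch X).GaussianMonoid lstar ≃* (archFrobeniusSide X).GaussianMonoid lstar :=
  gaussianKummerIso (ConstantMonoidDatum.ofArch X) (CommGrpCat.of X.OCˣ) (archUnitKummerMulEquiv X) lstar

/-- "restrict to … the [restriction to “`(−)^×`” of the] isomorphism of (i) … on the various copies of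
`Ψ^×_{†F_v}`, “`Ψ_cns(†U_v)^×`”" (p. 131): on a unit `(u, 0)` the archimedean theta isomorphism is `φ^×`.
[cite: Mochizuki2012, Prop 4.4 (iv) p.131] -/
theorem archThetaKummerIso_unit (u : X.OCˣ) :
    archThetaKummerIso X (u, 1) = (Units.mapEquiv (kummerIsoArch X) u, 1) := rfl

/-- **The chain identity of [IUTchII] Prop 4.4 (iv) at the archimedean data** (pp. 130–131 "a collection of
natural isomorphisms `Ψ_{†F^Θ_v} ⥲ Ψ_env(†U_v) ⥲ Ψ_gau(†U_v) ⥲ Ψ_{F_gau}(†F_v)`"): theta isomorphism, then the formal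
evaluation isomorphism `Ψ_env(†U_v) ⥲ Ψ_gau(†U_v)` of Prop 4.3 (iv) (`ConstantMonoidDatum.evalIsoOfArch`), then
`Ψ_gau ⥲ Ψ_{F_gau}` is exactly the Frobenioid-side formal evaluation isomorphism — PROVED.
[cite: Mochizuki2012, Prop 4.4 (iv) p.130] -/
theorem arch_evalIso_chain (lstar : ℕ) (hl : 0 < lstar) (x : (archFrobeniusSide X).ThetaMonoid) :
    archGaussianKummerIso X lstar
        ((ConstantMonoidDatum.ofArch X).evalIso lstar hl (archThetaKummerIso X x)) =
      (archFrobeniusSide X).evalIso lstar hl x :=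
  evalIso_chain (ConstantMonoidDatum.ofArch X) (CommGrpCat.of X.OCˣ) (archUnitKummerMulEquiv X) lstar hl x

/-- The formal evaluation isomorphism of Prop 4.3 (iv) used in the chain IS abc-iut's
`ConstantMonoidDatum.evalIsoOfArch` (`HodgeTheaterKitBridge.lean`). [cite: Mochizuki2012, Prop 4.4 (iv) p.130] -/
theorem evalIsoOfArch_eq (lstar : ℕ) (hl : 0 < lstar) :
    ConstantMonoidDatum.evalIsoOfArch X lstar hl = (ConstantMonoidDatum.ofArch X).evalIso lstar hl := rfl

end ThetaGaussianArch

end GoodPrimeKummer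

end Literature.IUT.HodgeArakelov

end
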